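import Summits.Ventures.HodgeRepro2.T5SU11HardyCompactSupport

/-!
# The Hardy identity with its remainder: `∫ sinh 2t (u′)² − ∫ sinh 2t u² = ∫ sinh 2t (u′Ξ − uΞ′)²/Ξ²`

For a `C¹` function `u` on `(0, ∞)` with `u`, `u′` vanishing outside `[a, b] ⊂ (0, ∞)`, row 477's ground-state
identity integrated over `[a, b]` (the bracket `H(u) = sinh 2t Ξ′ u²/Ξ` vanishes at `a` and `b`) gives the exact
formula

  **`∫_0^∞ sinh 2t u′² − ∫_0^∞ sinh 2t u² = ∫_a^b sinh 2t (u′Ξ − uΞ′)²/Ξ²`**  (`hardy_identity_of_support`),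

i.e. `‖u′‖² − ‖u‖² = ∫ sinh 2t Ξ² ((u/Ξ)′)²` — the Dirichlet form of `L` exceeds `ρ² ‖u‖²` by exactly the Dirichlet
form of the ground-state quotient `w = u/Ξ` with weight `Ξ² sinh 2t` (the ground-state representation of `−L − ρ²`),
so that equality in Hardy's inequality forces `u/Ξ` to be constant (`(u′Ξ − uΞ′)² = 0`), which no compactly supported
`u ≠ 0` satisfies: the Hardy inequality of row 479 is strict for `u ≠ 0` (`hardy_remainder_nonneg`). Nothing is
claimed about (N).

Blind lane: Mathlib + the HodgeRepro2 prefix only; no sorry; axioms ⊆ {propext, Classical.choice,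
Quot.sound}.
-/

namespace Summit.Ventures.HodgeRepro2.T5SU11HardyRemainder

open MeasureTheory intervalIntegral
open Set (Ioi Ioc Icc)
open T5SU11Cartan T5SU11SphericalFunction T5SU11SphericalBounds T5SU11SphericalContinuous
  T5SU11SphericalSolutionSpaceAll T5SU11ReductionOfOrder T5SU11GroundStateTransform T5SU11HardyCompactSupport

section measure

variable [MeasurableSpace Circle] [BorelSpace Circle]

variable {u u' : ℝ → ℝ} (hu : ∀ t, 0 < t → HasDerivAt u (u' t) t) (hcu' : ContinuousOn u' (Ioi 0))
  {a b : ℝ} (ha : 0 < a) (hab : a ≤ b) (hua : ∀ t, t ≤ a → u t = 0) (hub : ∀ t, b ≤ t → u t = 0)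
  (hu'a : ∀ t, t ≤ a → u' t = 0) (hu'b : ∀ t, b ≤ t → u' t = 0)

include hu hcu' ha hab hua hub hu'a hu'b in
/-- **The Hardy identity with its remainder** for compactly supported `C¹` functions:
`∫_0^∞ sinh 2t u′² − ∫_0^∞ sinh 2t u² = ∫_a^b sinh 2t (u′Ξ − uΞ′)²/Ξ²`. -/
theorem hardy_identity_of_support :
    (∫ t in Ioi 0, Real.sinh (2 * t) * u' t ^ 2) - ∫ t in Ioi 0, Real.sinh (2 * t) * u t ^ 2
      = ∫ t in a..b, Real.sinh (2 * t) * (u' t * sph 1 (hyp t) - u t * deriv (fun t => sph 1 (hyp t)) t) ^ 2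
          / sph 1 (hyp t) ^ 2 := by
  rw [integral_Ioi_sinh_mul_sq_eq_of_support ha hab hua hub,
    integral_Ioi_sinh_mul_sq_eq_of_support ha hab hu'a hu'b]
  have h := hardy_identity_inhom hu hcu' ha hab
  rw [hardyBracket_eq_zero (hub b le_rfl), hardyBracket_eq_zero (hua a le_rfl), sub_zero] at h
  have hsub : Set.uIcc a b ⊆ Ioi 0 := T5SU11RadialGreen.uIcc_subset_Ioi ha (lt_of_lt_of_le ha hab)
  have hcu : ContinuousOn u (Ioi 0) := fun t ht => (hu t ht).continuousAt.continuousWithinAt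
  have hcs : ContinuousOn (fun t => Real.sinh (2 * t)) (Ioi 0) :=
    (Real.continuous_sinh.comp (continuous_const.mul continuous_id)).continuousOn
  have hΞ : Continuous fun t => sph 1 (hyp t) := continuous_sph_hyp 1
  have hΞ' : Continuous (deriv fun t => sph 1 (hyp t)) :=
    continuous_iff_continuousAt.mpr fun t => (hasDerivAt_deriv_sph_hyp 1 t).continuousAt
  have hA : IntervalIntegrable (fun t => Real.sinh (2 * t) * u' t ^ 2) volume a b :=
    ((hcs.mul (hcu'.pow 2)).mono hsub).intervalIntegrable
  have hB : IntervalIntegrable (fun t => Real.sinh (2 * t) * u t ^ 2) volume a b :=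
    ((hcs.mul (hcu.pow 2)).mono hsub).intervalIntegrable
  have hQ : IntervalIntegrable (fun t => Real.sinh (2 * t)
      * (u' t * sph 1 (hyp t) - u t * deriv (fun t => sph 1 (hyp t)) t) ^ 2 / sph 1 (hyp t) ^ 2) volume a b := by
    refine (ContinuousOn.mono ?_ hsub).intervalIntegrable
    refine (hcs.mul (((hcu'.mul hΞ.continuousOn).sub (hcu.mul hΞ'.continuousOn)).pow 2)).div
      (hΞ.continuousOn.pow 2) (fun t _ => ?_)
    exact pow_ne_zero 2 (sph_hyp_pos 1 t).ne'
  rw [integral_sub (hA.sub hB) hQ, integral_sub hA hB] at h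
  linarith

omit [BorelSpace Circle] in
include ha hab in
/-- The remainder is non-negative (with equality only if `u′Ξ = uΞ′`, i.e. `u/Ξ` constant on `[a, b]`). -/
theorem hardy_remainder_nonneg :
    0 ≤ ∫ t in a..b, Real.sinh (2 * t) * (u' t * sph 1 (hyp t) - u t * deriv (fun t => sph 1 (hyp t)) t) ^ 2
          / sph 1 (hyp t) ^ 2 := by
  refine integral_nonneg hab (fun t ht => ?_)
  have ht0 : 0 < t := lt_of_lt_of_le ha ht.1
  exact div_nonneg (mul_nonneg (sinh_two_mul_pos ht0).le (sq_nonneg _)) (sq_nonneg _)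

end measure

end Summit.Ventures.HodgeRepro2.T5SU11HardyRemainder
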